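import Literature.MathematicalPhysics.QuantumFieldTheory.Balaban1983to89.B7Eq92Concrete

/-!
# Bałaban's renormalization group for 4-d lattice Yang–Mills — B7 Proposition 3, THE ANALYTICITY HALF (121)–(123)
# AT A GENERAL BACKGROUND `V₀`

citation: T. Bałaban, "Averaging operations for lattice gauge theories", Comm. Math. Phys. 98 (1985) 17–51, Sect. C,
Proposition 3, (120)–(123) pp. 35–36.  Bib key `Balaban1985Averaging` ([B7] of the crew's numbering).

p. 36: "Let us define Q(V₀, A, c) = (1/i) log (V̿₁)_c, (121) then Q(V₀, A, c) is an analytic function of A and from (120) it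
follows that its Taylor expansion begins with a first-order polynomial. […] C(V₀, A, c) is an analytic function of A whose
Taylor's expansion begins with a second-order polynomial (a quadratic form), and |C(V₀, A, c)| ≦ C₁L²|A|² < C₁(Lα₁)².
(123)" […] "The constant C₁ depends on d and c₃ depends on d and L."  Here `V₁ = e^{iA}` (p. 35 (120): "V̿₁ for
V₁ = exp iA, A small"), the double-bar average at the background `V₀` being (89) p. 31 — the tree's
`B7Eq92Concrete.dbavgCov L V₀ V₁`, with `V₁ := expCfg A` (the crew writes the Lie-algebra variable as `A` for print's `iA`,
as in `B7Prop3Flat`).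

WHAT THIS FILE PROVES (the analyticity clause of Prop. 3 and the domain it lives on, at a GENERAL unit-bounded background
`V₀` whose block contours are regular; the flat case `V₀ = 1` is `B7Prop3Flat.prop3_flat_analyticAt`):
* §1 `analyticAt_hol_mulCfg` … `analyticAt_dbavgCov_expCfg`: every contour holonomy of `e^{B(t)}·V₀`, the twisted holonomies
  (58) `(R_{0,y}V₁)(Γ)`, the frame exponents `F(y)` (62)/(82), the frames, the one-step averages (42) of `V₁V₀`, `Ṽ₁` (65) and
  the double-bar average `V̿₁(c)` (89) are complex-analytic in a parameter `t` on which the field `B(t)` depends analytically,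
  wherever the contour words entering the series logarithms (21) lie in `|W − 1| < 1` — pure composition of analytic maps
  (`NormedSpace.exp_analytic`, `ExpMeanLog.analyticAt_mlog`), the pattern of `B7Prop3Flat` §Analytic with `V₀` carried along.
* `analyticAt_mlog_dbavgCov_expCfg`: hence `(1/i) log V̿₁(c)` — print's `Q(V₀, A, c)` up to the unit `1/i` — is analytic in
  `t` wherever in addition `|V̿₁(c) − 1| < 1`.
These are the analyticity facts that (121)–(123) rest on; the first-order formula (124) and the bound (126) are the sequel's
(`B7Prop3GeneralRotated`, `B7Prop3GeneralLinear`), the quadratic remainder bound (123) follows from analyticity and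
boundedness on a polydisc by the Cauchy estimate (`Summits/…/Support/ShellMeasureAverageRemainder`).

Nothing here is specific to `SU(N)`: `𝔸` is any complete normed `ℂ`-algebra, as in `B7Prop3Flat`.

HONEST DEPENDENCY (cell pub-balaban, verbatim; this file reproduces one clause of one printed proposition and moves nothing
in it): continuum YM on T⁴ ⇐ BetaPertH ∧ nine spine estimates (0/9 proved); BetaPertH ⇐ (D1) ∧ (D4) ∧ CAP+tail; G-an2-4
gates asym, D1 and NE2/3/4.  Rung (B)+1 on a FINITE T⁴ — NOT infinite volume, NOT mass gap, NOT Clay; NE7c NOT PRINTED,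
NOT PROVED.

v1.1 (docstring only; declarations byte-identical): (123) quoted in full (referee DV-27 / XREAD C-ne7cleaf07-14 class), the
HONEST DEPENDENCY sentence added (DV-27).  LENGTH WAIVER (referee DV-28): 516 + 12 header lines; the trigger's ≤ 400 rule names
`Summits/…/ShellMeasure*.lean`; this Literature reproduction is kept in ONE module so that its importers
(`ShellMeasureAverageProp3Remainder`/`…Chart`/`…Discharge`, `ShellMeasureAverageProp4General`) and every FQN stay fixed; no
further growth — sequels go to new modules.
-/

noncomputable section

open scoped BigOperators
open NormedSpace Finset

namespace Literature.MathematicalPhysics.QuantumFieldTheory.Balaban1983to89.B7Prop3GeneralAnalytic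

open B7Prop1Explicit B7Prop3Flat B7Eq92Concrete MatrixLog

-- `Site` alone would resolve to the torus sites of `Setup.lean`; re-export the `ℤ^d` sites of `B7Prop1Explicit`.
export B7Prop1Explicit (Site)

variable {d : ℕ}

section Analytic

variable {𝔸 : Type*} [NormedRing 𝔸] [NormedAlgebra ℂ 𝔸] [CompleteSpace 𝔸]
variable {E : Type*} [NormedAddCommGroup E] [NormedSpace ℂ E]

/-- The bond variables of the product configuration `e^{B(t)}·V₀` and their inverses, `e^{B(t)_b}V₀(b)` and
`V₀(b)⁻¹e^{−B(t)_b}`, are analytic in `t`. [folklore] -/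
private theorem analyticAt_bond_mulCfg (B : E → Site d → Fin d → 𝔸) {t₀ : E}
    (hB : ∀ x κ, AnalyticAt ℂ (fun t => B t x κ) t₀) (V₀ : Site d → Fin d → 𝔸ˣ) (x : Site d) (μ : Fin d) :
    AnalyticAt ℂ (fun t => (((expCfg (B t) * V₀) x μ : 𝔸ˣ) : 𝔸)) t₀ ∧
      AnalyticAt ℂ (fun t => ((((expCfg (B t) * V₀) x μ)⁻¹ : 𝔸ˣ) : 𝔸)) t₀ := by
  refine ⟨?_, ?_⟩
  · have h : (fun t => (((expCfg (B t) * V₀) x μ : 𝔸ˣ) : 𝔸)) = fun t => exp (B t x μ) * (V₀ x μ : 𝔸) :=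
      funext fun t => by simp only [Pi.mul_apply, Units.val_mul, expCfg, val_expUnit]
    rw [h]
    exact ((exp_analytic _).fun_comp_of_eq (hB x μ) rfl).fun_mul analyticAt_const
  · have h : (fun t => ((((expCfg (B t) * V₀) x μ)⁻¹ : 𝔸ˣ) : 𝔸))
        = fun t => (((V₀ x μ)⁻¹ : 𝔸ˣ) : 𝔸) * exp (-B t x μ) :=
      funext fun t => by simp only [Pi.mul_apply, mul_inv_rev, Units.val_mul, expCfg, val_inv_expUnit, val_expUnit]
    rw [h]
    exact analyticAt_const.fun_mul ((exp_analytic _).fun_comp_of_eq (hB x μ).neg rfl)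

/-- One step of parallel transport (9) of `e^{B(t)}·V₀` and its inverse are analytic in `t`. [folklore] -/
private theorem analyticAt_stepHol_mulCfg (B : E → Site d → Fin d → 𝔸) {t₀ : E}
    (hB : ∀ x κ, AnalyticAt ℂ (fun t => B t x κ) t₀) (V₀ : Site d → Fin d → 𝔸ˣ) (x : Site d) (l : Letter d) :
    AnalyticAt ℂ (fun t => ((stepHol (expCfg (B t) * V₀) x l : 𝔸ˣ) : 𝔸)) t₀ ∧
      AnalyticAt ℂ (fun t => (((stepHol (expCfg (B t) * V₀) x l)⁻¹ : 𝔸ˣ) : 𝔸)) t₀ := by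
  obtain ⟨μ, b⟩ := l
  cases b
  · obtain ⟨h1, h2⟩ := analyticAt_bond_mulCfg B hB V₀ (x - e μ) μ
    simp only [stepHol_false, inv_inv]
    exact ⟨h2, h1⟩
  · simpa only [stepHol_true] using analyticAt_bond_mulCfg B hB V₀ x μ

/-- **(9)** for the product configuration: every contour holonomy `(e^{B(t)}V₀)(Γ)` and its inverse are analytic in `t`
(finite products of the analytic bond variables). [cite: Balaban1985Averaging, (9) p.18] -/
theorem analyticAt_hol_mulCfg (B : E → Site d → Fin d → 𝔸) {t₀ : E}
    (hB : ∀ x κ, AnalyticAt ℂ (fun t => B t x κ) t₀) (V₀ : Site d → Fin d → 𝔸ˣ) :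
    ∀ (w : List (Letter d)) (x : Site d),
      AnalyticAt ℂ (fun t => ((hol (expCfg (B t) * V₀) x w : 𝔸ˣ) : 𝔸)) t₀ ∧
        AnalyticAt ℂ (fun t => (((hol (expCfg (B t) * V₀) x w)⁻¹ : 𝔸ˣ) : 𝔸)) t₀
  | [], x => by simp only [hol_nil, inv_one, Units.val_one]; exact ⟨analyticAt_const, analyticAt_const⟩
  | l :: w, x => by
      obtain ⟨h1, h2⟩ := analyticAt_hol_mulCfg B hB V₀ w (x + l.vec)
      obtain ⟨s1, s2⟩ := analyticAt_stepHol_mulCfg B hB V₀ x l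
      refine ⟨?_, ?_⟩
      · simp only [hol_cons, Units.val_mul]
        exact s1.fun_mul h1
      · simp only [hol_cons, mul_inv_rev, Units.val_mul]
        exact h2.fun_mul s2

/-- **(58)** the twisted holonomy `(R_{0,y}V₁)(Γ) = (V₁V₀)(Γ)·V₀(Γ)⁻¹` of `V₁ = e^{B(t)}` and its inverse are analytic
in `t`. [cite: Balaban1985Averaging, (58) p.27] -/
theorem analyticAt_tHol_expCfg (B : E → Site d → Fin d → 𝔸) {t₀ : E}
    (hB : ∀ x κ, AnalyticAt ℂ (fun t => B t x κ) t₀) (V₀ : Site d → Fin d → 𝔸ˣ) (y : Site d)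
    (w : List (Letter d)) :
    AnalyticAt ℂ (fun t => ((tHol V₀ (expCfg (B t)) y w : 𝔸ˣ) : 𝔸)) t₀ ∧
      AnalyticAt ℂ (fun t => (((tHol V₀ (expCfg (B t)) y w)⁻¹ : 𝔸ˣ) : 𝔸)) t₀ := by
  obtain ⟨h1, h2⟩ := analyticAt_hol_mulCfg B hB V₀ w y
  refine ⟨?_, ?_⟩
  · simp only [tHol, Units.val_mul]
    exact h1.fun_mul analyticAt_const
  · simp only [tHol, mul_inv_rev, inv_inv, Units.val_mul]
    exact analyticAt_const.fun_mul h2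

/-- The frame exponent `F(y) = Σ_{x∈B(y)} L^{−d} log (R_{0,y}V₁)(Γ_{y,x})` (62)/(82) of `V₁ = e^{B(t)}` is analytic in `t`
wherever every twisted tree holonomy lies in the domain `|W − 1| < 1` of the series logarithm (21).
[cite: Balaban1985Averaging, (62) p.28, (82) p.30] -/
theorem analyticAt_Fcov_expCfg (B : E → Site d → Fin d → 𝔸) {t₀ : E}
    (hB : ∀ x κ, AnalyticAt ℂ (fun t => B t x κ) t₀) (L : ℕ) (V₀ : Site d → Fin d → 𝔸ˣ) (y : Site d)
    (hT : ∀ r : Fin d → Fin L,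
      ‖((tHol V₀ (expCfg (B t₀)) y (treeWord (boxVec L r)) : 𝔸ˣ) : 𝔸) - 1‖ < 1) :
    AnalyticAt ℂ (fun t => Fcov L V₀ (expCfg (B t)) y) t₀ := by
  unfold Fcov
  exact Finset.analyticAt_fun_sum _ fun r _ =>
    ((ExpMeanLog.analyticAt_mlog (hT r)).fun_comp_of_eq (analyticAt_tHol_expCfg B hB V₀ y _).1 rfl).fun_const_smul

/-- The block frame `\overline{R_{0,y}V₁} = e^{F(y)}` (82) of `V₁ = e^{B(t)}` and its inverse are analytic in `t` (same
domain condition). [cite: Balaban1985Averaging, (82) p.30, (62) p.28] -/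
theorem analyticAt_wframe_expCfg (B : E → Site d → Fin d → 𝔸) {t₀ : E}
    (hB : ∀ x κ, AnalyticAt ℂ (fun t => B t x κ) t₀) (L : ℕ) (V₀ : Site d → Fin d → 𝔸ˣ) (y : Site d)
    (hT : ∀ r : Fin d → Fin L,
      ‖((tHol V₀ (expCfg (B t₀)) y (treeWord (boxVec L r)) : 𝔸ˣ) : 𝔸) - 1‖ < 1) :
    AnalyticAt ℂ (fun t => ((wframe L V₀ (expCfg (B t)) y : 𝔸ˣ) : 𝔸)) t₀ ∧
      AnalyticAt ℂ (fun t => (((wframe L V₀ (expCfg (B t)) y)⁻¹ : 𝔸ˣ) : 𝔸)) t₀ := by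
  refine ⟨?_, ?_⟩
  · simp only [wframe, val_expUnit]
    exact (exp_analytic _).fun_comp_of_eq (analyticAt_Fcov_expCfg B hB L V₀ y hT) rfl
  · simp only [wframe, val_inv_expUnit]
    exact (exp_analytic _).fun_comp_of_eq (analyticAt_Fcov_expCfg B hB L V₀ y hT).neg rfl

/-- The exponent `X_c` of the one-step average (42) of the product `V₁V₀`, `V₁ = e^{B(t)}`, is analytic in `t` wherever
every `(V₁V₀)(Γ_{c,x})(V₁V₀)(c)⁻¹` lies in `|W − 1| < 1`. [cite: Balaban1985Averaging, (42) p.23] -/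
theorem analyticAt_Xavg_mulCfg (B : E → Site d → Fin d → 𝔸) {t₀ : E}
    (hB : ∀ x κ, AnalyticAt ℂ (fun t => B t x κ) t₀) (L : ℕ) (V₀ : Site d → Fin d → 𝔸ˣ) (q : Site d) (κ : Fin d)
    (hW : ∀ r : Fin d → Fin L, ‖((Wcx L (expCfg (B t₀) * V₀) q κ (boxVec L r) : 𝔸ˣ) : 𝔸) - 1‖ < 1) :
    AnalyticAt ℂ (fun t => Xavg L (expCfg (B t) * V₀) q κ) t₀ := by
  unfold Xavg
  refine Finset.analyticAt_fun_sum _ fun r _ => ?_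
  have h := (analyticAt_hol_mulCfg B hB V₀ (gammaWord L κ (boxVec L r) ++ seg κ (-(L : ℤ))) q).1
  simp only [← Wcx_eq_hol_loop] at h
  exact ((ExpMeanLog.analyticAt_mlog (hW r)).fun_comp_of_eq h rfl).fun_const_smul

/-- The one-step average (42) `(\overline{V₁V₀})(c) = e^{X_c}·(V₁V₀)(c)` of the product, `V₁ = e^{B(t)}`, is analytic in `t`
(same domain condition). [cite: Balaban1985Averaging, (42) p.23, (65) p.29] -/
theorem analyticAt_bavg_mulCfg (B : E → Site d → Fin d → 𝔸) {t₀ : E}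
    (hB : ∀ x κ, AnalyticAt ℂ (fun t => B t x κ) t₀) (L : ℕ) (V₀ : Site d → Fin d → 𝔸ˣ) (q : Site d) (κ : Fin d)
    (hW : ∀ r : Fin d → Fin L, ‖((Wcx L (expCfg (B t₀) * V₀) q κ (boxVec L r) : 𝔸ˣ) : 𝔸) - 1‖ < 1) :
    AnalyticAt ℂ (fun t => ((bavg L (expCfg (B t) * V₀) q κ : 𝔸ˣ) : 𝔸)) t₀ := by
  simp only [val_bavg]
  exact ((exp_analytic _).fun_comp_of_eq (analyticAt_Xavg_mulCfg B hB L V₀ q κ hW) rfl).fun_mul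
    (analyticAt_hol_mulCfg B hB V₀ _ q).1

/-- **(65)** `Ṽ₁(c) = (\overline{V₁V₀})(c)·(V̄₀)(c)⁻¹`, `V₁ = e^{B(t)}`, is analytic in `t` (same domain condition; the
second factor does not depend on `t`). [cite: Balaban1985Averaging, (65) p.29] -/
theorem analyticAt_tild_expCfg (B : E → Site d → Fin d → 𝔸) {t₀ : E}
    (hB : ∀ x κ, AnalyticAt ℂ (fun t => B t x κ) t₀) (L : ℕ) (V₀ : Site d → Fin d → 𝔸ˣ) (q : Site d) (κ : Fin d)
    (hW : ∀ r : Fin d → Fin L, ‖((Wcx L (expCfg (B t₀) * V₀) q κ (boxVec L r) : 𝔸ˣ) : 𝔸) - 1‖ < 1) :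
    AnalyticAt ℂ (fun t => ((tild L V₀ (expCfg (B t)) q κ : 𝔸ˣ) : 𝔸)) t₀ := by
  simp only [tild_apply, Units.val_mul]
  exact (analyticAt_bavg_mulCfg B hB L V₀ q κ hW).fun_mul analyticAt_const

/-- **(89)** the double-bar average `V̿₁(c) = (\overline{R_{0,c₋}V₁})⁻¹ Ṽ₁(c) R̄_{0,c}\overline{R_{0,c₊}V₁}` of `V₁ = e^{B(t)}`
at the background `V₀` is analytic in `t` wherever the contour words entering `X_c`, `F(c₋)`, `F(c₊)` lie in the domain of
the series logarithm (21). [cite: Balaban1985Averaging, (89) p.31, (120) p.35] -/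
theorem analyticAt_dbavgCov_expCfg (B : E → Site d → Fin d → 𝔸) {t₀ : E}
    (hB : ∀ x κ, AnalyticAt ℂ (fun t => B t x κ) t₀) (L : ℕ) (V₀ : Site d → Fin d → 𝔸ˣ) (q : Site d) (κ : Fin d)
    (hW : ∀ r : Fin d → Fin L, ‖((Wcx L (expCfg (B t₀) * V₀) q κ (boxVec L r) : 𝔸ˣ) : 𝔸) - 1‖ < 1)
    (hT₁ : ∀ r : Fin d → Fin L,
      ‖((tHol V₀ (expCfg (B t₀)) q (treeWord (boxVec L r)) : 𝔸ˣ) : 𝔸) - 1‖ < 1)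
    (hT₂ : ∀ r : Fin d → Fin L,
      ‖((tHol V₀ (expCfg (B t₀)) (q + (L : ℤ) • e κ) (treeWord (boxVec L r)) : 𝔸ˣ) : 𝔸) - 1‖ < 1) :
    AnalyticAt ℂ (fun t => ((dbavgCov L V₀ (expCfg (B t)) q κ : 𝔸ˣ) : 𝔸)) t₀ := by
  simp only [dbavgCov_apply, Rc_apply, Units.val_mul]
  exact (((analyticAt_wframe_expCfg B hB L V₀ q hT₁).2.fun_mul (analyticAt_tild_expCfg B hB L V₀ q κ hW)).fun_mul
    ((analyticAt_const.fun_mul (analyticAt_wframe_expCfg B hB L V₀ _ hT₂).1).fun_mul analyticAt_const))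

/-- **(121)** `Q(V₀, A, c) = (1/i) log V̿₁(c)` is analytic: `log V̿₁(c)` (series logarithm (21)) of `V₁ = e^{B(t)}` at the
background `V₀` is analytic in `t` wherever the contour words entering (89) lie in the domain of the logarithm and
`|V̿₁(c) − 1| < 1`.  (The unit `1/i` is immaterial to analyticity.) [cite: Balaban1985Averaging, (121) p.36] -/
theorem analyticAt_mlog_dbavgCov_expCfg (B : E → Site d → Fin d → 𝔸) {t₀ : E}
    (hB : ∀ x κ, AnalyticAt ℂ (fun t => B t x κ) t₀) (L : ℕ) (V₀ : Site d → Fin d → 𝔸ˣ) (q : Site d) (κ : Fin d)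
    (hW : ∀ r : Fin d → Fin L, ‖((Wcx L (expCfg (B t₀) * V₀) q κ (boxVec L r) : 𝔸ˣ) : 𝔸) - 1‖ < 1)
    (hT₁ : ∀ r : Fin d → Fin L,
      ‖((tHol V₀ (expCfg (B t₀)) q (treeWord (boxVec L r)) : 𝔸ˣ) : 𝔸) - 1‖ < 1)
    (hT₂ : ∀ r : Fin d → Fin L,
      ‖((tHol V₀ (expCfg (B t₀)) (q + (L : ℤ) • e κ) (treeWord (boxVec L r)) : 𝔸ˣ) : 𝔸) - 1‖ < 1)
    (hD : ‖((dbavgCov L V₀ (expCfg (B t₀)) q κ : 𝔸ˣ) : 𝔸) - 1‖ < 1) :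
    AnalyticAt ℂ (fun t => mlog ((dbavgCov L V₀ (expCfg (B t)) q κ : 𝔸ˣ) : 𝔸)) t₀ :=
  (ExpMeanLog.analyticAt_mlog hD).fun_comp_of_eq (analyticAt_dbavgCov_expCfg B hB L V₀ q κ hW hT₁ hT₂) rfl

end Analytic

/-! ## The domain conditions from the regularity of `V₀` and the smallness of `A`

Print, p. 35 (120): "V̿₁ for V₁ = exp iA, A small", p. 36: "analytic function of A […] for |A_b| < c₃(d, L)", the
background `V₀` being a configuration of the regular class of Sect. C (its block contours `V₀(Γ_{c,x})V₀(c)⁻¹` close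
to `1`, (43)–(44) p. 24 from the plaquette regularity (26) via Proposition 1).  Below: every contour word entering (89)
is within the domain `|W − 1| < 1` of the series logarithm (21), and `|V̿₁(c) − 1| ≤ 4/5`, as soon as
`(2d+2)L·sup_b|A_b| ≤ θ ≤ 1/64` and the block contours of `V₀` are `α`-regular with `α ≤ 1/64` — the general-background
twin of `B7Prop3Flat.logDomain_of_le_c3` (there `V₀ = 1`, `α = 0`). -/

section Algebra

variable {G : Type*} [Group G]

/-- **(58) one bond at a time, from the left**: prepending the letter `l` at `y` to `Γ` conjugates `(R_{0,y+l}V₁)(Γ)` by the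
one-step transport of `V₀` and multiplies on the left by the one-step transport of `V₁V₀` — `t(lΓ) = (V₁V₀)(l)·t(Γ)·V₀(l)⁻¹`.
[cite: Balaban1985Averaging, (58) p.27] -/
theorem tHol_cons (V₀ V₁ : Site d → Fin d → G) (y : Site d) (l : Letter d) (w : List (Letter d)) :
    tHol V₀ V₁ y (l :: w) = stepHol (V₁ * V₀) y l * tHol V₀ V₁ (y + l.vec) w * (stepHol V₀ y l)⁻¹ := by
  simp only [tHol, hol_cons, mul_inv_rev, mul_assoc]

end Algebra

section Estimates

variable {𝔸 : Type*} [NormedRing 𝔸] [NormedAlgebra ℂ 𝔸] [CompleteSpace 𝔸] [NormOneClass 𝔸]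

omit [NormedAlgebra ℂ 𝔸] [CompleteSpace 𝔸] [NormOneClass 𝔸] in
/-- `|XY − 1| ≤ x + y + xy` when `|X − 1| ≤ x`, `|Y − 1| ≤ y` (`XY − 1 = (X − 1)(Y − 1) + (X − 1) + (Y − 1)`). [folklore] -/
private theorem norm_mul_sub_one_le {X Y : 𝔸} {x y : ℝ} (hX : ‖X - 1‖ ≤ x) (hY : ‖Y - 1‖ ≤ y) (hx : 0 ≤ x) :
    ‖X * Y - 1‖ ≤ x + y + x * y := by
  have h : X * Y - 1 = (X - 1) * (Y - 1) + (X - 1) + (Y - 1) := by noncomm_ring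
  rw [h]
  calc ‖(X - 1) * (Y - 1) + (X - 1) + (Y - 1)‖ ≤ ‖(X - 1) * (Y - 1)‖ + ‖X - 1‖ + ‖Y - 1‖ := norm_add₃_le
    _ ≤ ‖X - 1‖ * ‖Y - 1‖ + ‖X - 1‖ + ‖Y - 1‖ := by gcongr; exact norm_mul_le _ _
    _ ≤ x * y + x + y := by gcongr
    _ = x + y + x * y := by ring

omit [NormedAlgebra ℂ 𝔸] [CompleteSpace 𝔸] in
/-- `|X| ≤ 1 + |X − 1|`. [folklore] -/
private theorem norm_le_one_add_norm_sub_one (X : 𝔸) : ‖X‖ ≤ 1 + ‖X - 1‖ := by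
  have h := norm_add_le (X - 1) (1 : 𝔸)
  rw [sub_add_cancel, norm_one] at h
  linarith

omit [NormOneClass 𝔸] in
/-- `|e^{Y} − 1| ≤ 2|Y|` for `|Y| ≤ 1` (`|e^{Y} − 1| ≤ e^{|Y|} − 1` termwise, and `e^{s} − 1 ≤ 2s` on `[0, 1]`,
Mathlib's `Real.abs_exp_sub_one_le`). [folklore] -/
private theorem norm_exp_sub_one_le_two_mul {Y : 𝔸} (h : ‖Y‖ ≤ 1) : ‖exp Y - 1‖ ≤ 2 * ‖Y‖ := by
  have h1 := (norm_exp_sub_one_le_of_norm_le (le_refl ‖Y‖)).1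
  have h2 := Real.abs_exp_sub_one_le (x := ‖Y‖) (by rwa [abs_of_nonneg (norm_nonneg _)])
  rw [abs_of_nonneg (norm_nonneg Y)] at h2
  exact h1.trans ((le_abs_self _).trans h2)

/-- **The twisted holonomy of a small field is close to `1`**: for `V₁ = e^{A}`, `|A_b| ≤ a`, and a unit-bounded
background `V₀` (`|V₀(b)|, |V₀(b)⁻¹| ≤ 1`), `|(R_{0,y}V₁)(Γ) − 1| ≤ e^{|Γ|a} − 1` — by (58): `(R_{0,y}V₁)(Γ)` is an ordered
product of `|Γ|` factors `R(V₀(Γ′))V₁(b)^{±1}`, each within `e^{a} − 1` of `1` since conjugation by unit-bounded elements does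
not increase `|· − 1|`. [cite: Balaban1985Averaging, (58) p.27, (47) p.25] -/
theorem norm_tHol_expCfg_sub_one_le {V₀ : Site d → Fin d → 𝔸ˣ} (hV₀ : ∀ x κ, V₀ x κ ∈ U1 𝔸)
    (A : Site d → Fin d → 𝔸) {a : ℝ} (hA : ∀ x κ, ‖A x κ‖ ≤ a) :
    ∀ (w : List (Letter d)) (y : Site d),
      ‖((tHol V₀ (expCfg A) y w : 𝔸ˣ) : 𝔸) - 1‖ ≤ Real.exp (w.length * a) - 1
  | [], y => by simp
  | (μ, true) :: w, y => by
      have ih := norm_tHol_expCfg_sub_one_le hV₀ A hA w (y + e μ)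
      have ha : 0 ≤ Real.exp a - 1 := by
        have : 0 ≤ a := (norm_nonneg _).trans (hA y μ)
        linarith [Real.add_one_le_exp a]
      have hval : ((tHol V₀ (expCfg A) y ((μ, true) :: w) : 𝔸ˣ) : 𝔸)
          = exp (A y μ) * (((V₀ y μ : 𝔸ˣ) : 𝔸) * ((tHol V₀ (expCfg A) (y + e μ) w : 𝔸ˣ) : 𝔸)
              * (((V₀ y μ)⁻¹ : 𝔸ˣ) : 𝔸)) := by
        rw [tHol_cons]
        simp only [stepHol_true, Pi.mul_apply, Letter.vec_true, Units.val_mul, expCfg, val_expUnit, mul_assoc]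
      rw [hval, List.length_cons, Nat.cast_succ, add_mul, one_mul, add_comm (_ * a) a]
      have h1 : ‖exp (A y μ) - 1‖ ≤ Real.exp a - 1 := (norm_exp_sub_one_le_of_norm_le (hA y μ)).1
      have h2 := (norm_units_conj_sub_one_le (hV₀ y μ) _).trans ih
      refine (norm_mul_sub_one_le h1 h2 ha).trans (le_of_eq ?_)
      rw [Real.exp_add]; ring
  | (μ, false) :: w, y => by
      have ih := norm_tHol_expCfg_sub_one_le hV₀ A hA w (y + -e μ)
      have ha : 0 ≤ Real.exp a - 1 := by
        have : 0 ≤ a := (norm_nonneg _).trans (hA y μ)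
        linarith [Real.add_one_le_exp a]
      have hval : ((tHol V₀ (expCfg A) y ((μ, false) :: w) : 𝔸ˣ) : 𝔸)
          = (((V₀ (y - e μ) μ)⁻¹ : 𝔸ˣ) : 𝔸) * (exp (-A (y - e μ) μ) * ((tHol V₀ (expCfg A) (y + -e μ) w : 𝔸ˣ) : 𝔸))
              * ((V₀ (y - e μ) μ : 𝔸ˣ) : 𝔸) := by
        rw [tHol_cons]
        simp only [stepHol_false, Pi.mul_apply, Letter.vec_false, mul_inv_rev, inv_inv, Units.val_mul, expCfg,
          val_inv_expUnit, val_expUnit, mul_assoc]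
      rw [hval, List.length_cons, Nat.cast_succ, add_mul, one_mul, add_comm (_ * a) a]
      have h1 : ‖exp (-A (y - e μ) μ) - 1‖ ≤ Real.exp a - 1 :=
        (norm_exp_sub_one_le_of_norm_le ((norm_neg _).le.trans (hA _ μ))).1
      refine ((norm_units_inv_conj_sub_one_le (hV₀ (y - e μ) μ) _).trans (norm_mul_sub_one_le h1 ih ha)).trans
        (le_of_eq ?_)
      rw [Real.exp_add]; ring

/-- … hence `|(R_{0,y}V₁)(Γ) − 1| ≤ 2θ` for every contour of length `≤ n` once `n·a ≤ θ ≤ 1/64` (`e^{s} − 1 ≤ 2θ` for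
`s ≤ θ ≤ 1/64`). [cite: Balaban1985Averaging, (47) p.25, (58) p.27] -/
theorem norm_tHol_expCfg_sub_one_le_of_length {V₀ : Site d → Fin d → 𝔸ˣ} (hV₀ : ∀ x κ, V₀ x κ ∈ U1 𝔸)
    (A : Site d → Fin d → 𝔸) {a θ : ℝ} (ha : 0 ≤ a) (hA : ∀ x κ, ‖A x κ‖ ≤ a) {n : ℕ} (hθ : (n : ℝ) * a ≤ θ)
    (hθ0 : 0 ≤ θ) (hθ1 : θ ≤ 1 / 64) {w : List (Letter d)} (hw : w.length ≤ n) (y : Site d) :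
    ‖((tHol V₀ (expCfg A) y w : 𝔸ˣ) : 𝔸) - 1‖ ≤ 2 * θ :=
  (norm_tHol_expCfg_sub_one_le hV₀ A hA w y).trans
    (exp_sub_one_le_of_le ((mul_le_mul_of_nonneg_right (by exact_mod_cast hw) ha).trans hθ) hθ0 hθ1)

omit [NormOneClass 𝔸] in
/-- `|X_c| ≤ 2w` when every block contour `V(Γ_{c,x})V(c)⁻¹` of the configuration is within `w ≤ 1/2` of `1`
(`|log W| ≤ 2|W − 1|`, and the weights `L^{−d}` average). [cite: Balaban1985Averaging, (42) p.23, (47) p.25] -/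
theorem norm_Xavg_le_of_Wcx {L : ℕ} (hL : 1 ≤ L) (V : Site d → Fin d → 𝔸ˣ) (q : Site d) (κ : Fin d) {w : ℝ}
    (hw : ∀ r : Fin d → Fin L, ‖((Wcx L V q κ (boxVec L r) : 𝔸ˣ) : 𝔸) - 1‖ ≤ w) (hw2 : w ≤ 1 / 2) :
    ‖Xavg L V q κ‖ ≤ 2 * w := by
  unfold Xavg
  exact norm_avg_le L hL _ fun r => (norm_mlog_le_two_mul ((hw r).trans hw2)).trans (by linarith [hw r])

omit [NormOneClass 𝔸] in
/-- `|F(y)| ≤ 2τ` when every twisted tree holonomy `(R_{0,y}V₁)(Γ_{y,x})` is within `τ ≤ 1/2` of `1`.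
[cite: Balaban1985Averaging, (62) p.28, (82) p.30] -/
theorem norm_Fcov_le_of_tHol {L : ℕ} (hL : 1 ≤ L) (V₀ V₁ : Site d → Fin d → 𝔸ˣ) (y : Site d) {τ : ℝ}
    (hτ : ∀ r : Fin d → Fin L, ‖((tHol V₀ V₁ y (treeWord (boxVec L r)) : 𝔸ˣ) : 𝔸) - 1‖ ≤ τ) (hτ2 : τ ≤ 1 / 2) :
    ‖Fcov L V₀ V₁ y‖ ≤ 2 * τ := by
  unfold Fcov
  exact norm_avg_le L hL _ fun r => (norm_mlog_le_two_mul ((hτ r).trans hτ2)).trans (by linarith [hτ r])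

omit [NormedAlgebra ℂ 𝔸] [CompleteSpace 𝔸] [NormOneClass 𝔸] in
/-- The block contour of the product splits: `(V₁V₀)(Γ_{c,x})(V₁V₀)(c)⁻¹ = (R_{0,c₋}V₁)(Γ_{c,x} ∪ (−Γ_c)) · V₀(Γ_{c,x})V₀(c)⁻¹`.
[cite: Balaban1985Averaging, (58) p.27, (42) p.23] -/
theorem Wcx_mul_eq_tHol_mul (L : ℕ) (V₀ V₁ : Site d → Fin d → 𝔸ˣ) (q : Site d) (κ : Fin d) (r : Site d) :
    Wcx L (V₁ * V₀) q κ r = tHol V₀ V₁ q (gammaWord L κ r ++ seg κ (-(L : ℤ))) * Wcx L V₀ q κ r := by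
  rw [Wcx_eq_hol_loop, Wcx_eq_hol_loop, tHol, inv_mul_cancel_right]

omit [NormOneClass 𝔸] in
/-- **(65) rearranged**: `Ṽ₁(c) = e^{X_c(V₁V₀)} · (R_{0,c₋}V₁)(Γ_c) · e^{−X_c(V₀)}` (`Γ_c` the straight contour of the
`L`-bond `c`). [cite: Balaban1985Averaging, (65) p.29, (42) p.23] -/
theorem tild_eq_exp_tHol_exp (L : ℕ) (V₀ V₁ : Site d → Fin d → 𝔸ˣ) (q : Site d) (κ : Fin d) :
    tild L V₀ V₁ q κ = expUnit (Xavg L (V₁ * V₀) q κ) * tHol V₀ V₁ q (seg κ L) * expUnit (-Xavg L V₀ q κ) := by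
  simp only [tild_apply, bavg, tHol, mul_inv_rev, val_inv_expUnit, mul_assoc]

/-- **THE DOMAIN CONDITIONS AT A GENERAL BACKGROUND** (general-`V₀` twin of `B7Prop3Flat.logDomain_of_le_c3`): if
`V₁ = e^{A}` with `(2d+2)L·sup_b|A_b| ≤ θ ≤ 1/64`, and the background `V₀` is unit-bounded with `α`-regular block contours at
the `L`-bond `c = ⟨q, q + Le_κ⟩` (`|V₀(Γ_{c,x})V₀(c)⁻¹ − 1| ≤ α ≤ 1/64`, print's (43)–(44) for the regular class of
Sect. C), then every block contour of `V₁V₀` at `c` is within `1/16` of `1`, every twisted tree holonomy at `c₋`, `c₊` within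
`1/32`, and `|V̿₁(c) − 1| ≤ 4/5`. [cite: Balaban1985Averaging, (120) p.35, (47) p.25, (43) p.24] -/
theorem logDomainCov {L : ℕ} (hL : 1 ≤ L) {V₀ : Site d → Fin d → 𝔸ˣ} (hV₀ : ∀ x κ, V₀ x κ ∈ U1 𝔸)
    (A : Site d → Fin d → 𝔸) {a θ α : ℝ} (ha : 0 ≤ a) (hA : ∀ x κ, ‖A x κ‖ ≤ a)
    (hθ : ((2 * (d * L) + L + L : ℕ) : ℝ) * a ≤ θ) (hθ0 : 0 ≤ θ) (hθ1 : θ ≤ 1 / 64)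
    (q : Site d) (κ : Fin d) (hα1 : α ≤ 1 / 64)
    (hreg : ∀ r : Fin d → Fin L, ‖((Wcx L V₀ q κ (boxVec L r) : 𝔸ˣ) : 𝔸) - 1‖ ≤ α) :
    (∀ r : Fin d → Fin L, ‖((Wcx L (expCfg A * V₀) q κ (boxVec L r) : 𝔸ˣ) : 𝔸) - 1‖ ≤ 1 / 16) ∧
    (∀ r : Fin d → Fin L, ‖((tHol V₀ (expCfg A) q (treeWord (boxVec L r)) : 𝔸ˣ) : 𝔸) - 1‖ ≤ 1 / 32) ∧
    (∀ r : Fin d → Fin L,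
      ‖((tHol V₀ (expCfg A) (q + (L : ℤ) • e κ) (treeWord (boxVec L r)) : 𝔸ˣ) : 𝔸) - 1‖ ≤ 1 / 32) ∧
    ‖((dbavgCov L V₀ (expCfg A) q κ : 𝔸ˣ) : 𝔸) - 1‖ ≤ 4 / 5 := by
  -- every contour entering (89) has length `≤ (2d+2)L`, so its twisted holonomy is within `2θ ≤ 1/32` of `1`
  have hτ : ∀ (w : List (Letter d)) (y : Site d), w.length ≤ 2 * (d * L) + L + L →
      ‖((tHol V₀ (expCfg A) y w : 𝔸ˣ) : 𝔸) - 1‖ ≤ 1 / 32 := fun w y hw =>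
    (norm_tHol_expCfg_sub_one_le_of_length hV₀ A ha hA hθ hθ0 hθ1 hw y).trans (by linarith)
  have htree : ∀ r : Fin d → Fin L, (treeWord (boxVec L r)).length ≤ 2 * (d * L) + L + L := fun r => by
    rw [length_treeWord]; have := l1_boxVec_le (L := L) r; omega
  have hloop : ∀ r : Fin d → Fin L,
      (gammaWord L κ (boxVec L r) ++ seg κ (-(L : ℤ))).length ≤ 2 * (d * L) + L + L := fun r => by
    rw [List.length_append, length_gammaWord, length_seg, Int.natAbs_neg, Int.natAbs_natCast]
    have := l1_boxVec_le (L := L) r; omega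
  have hseg : (seg κ (L : ℤ) : List (Letter d)).length ≤ 2 * (d * L) + L + L := by
    rw [length_seg, Int.natAbs_natCast]; omega
  have hT₁ : ∀ r : Fin d → Fin L,
      ‖((tHol V₀ (expCfg A) q (treeWord (boxVec L r)) : 𝔸ˣ) : 𝔸) - 1‖ ≤ 1 / 32 := fun r => hτ _ _ (htree r)
  have hT₂ : ∀ r : Fin d → Fin L,
      ‖((tHol V₀ (expCfg A) (q + (L : ℤ) • e κ) (treeWord (boxVec L r)) : 𝔸ˣ) : 𝔸) - 1‖ ≤ 1 / 32 :=
    fun r => hτ _ _ (htree r)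
  -- block contours of the product: `(1 + 1/32)(1 + α) − 1 ≤ 1/16`
  have hW : ∀ r : Fin d → Fin L, ‖((Wcx L (expCfg A * V₀) q κ (boxVec L r) : 𝔸ˣ) : 𝔸) - 1‖ ≤ 1 / 16 := by
    intro r
    rw [Wcx_mul_eq_tHol_mul, Units.val_mul]
    refine (norm_mul_sub_one_le (hτ _ _ (hloop r)) (hreg r) (by norm_num)).trans ?_
    nlinarith
  refine ⟨hW, hT₁, hT₂, ?_⟩
  -- the exponents `X_c(V₁V₀)`, `X_c(V₀)` and the frames
  have hX' : ‖Xavg L (expCfg A * V₀) q κ‖ ≤ 1 / 8 :=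
    (norm_Xavg_le_of_Wcx hL _ q κ hW (by norm_num)).trans (by norm_num)
  have hX₀ : ‖Xavg L V₀ q κ‖ ≤ 1 / 32 := (norm_Xavg_le_of_Wcx hL _ q κ hreg (by linarith)).trans (by linarith)
  have hE' : ‖exp (Xavg L (expCfg A * V₀) q κ) - 1‖ ≤ 1 / 4 :=
    (norm_exp_sub_one_le_two_mul (hX'.trans (by norm_num))).trans (by linarith)
  have hE₀ : ‖exp (Xavg L V₀ q κ) - 1‖ ≤ 1 / 16 :=
    (norm_exp_sub_one_le_two_mul (hX₀.trans (by norm_num))).trans (by linarith)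
  have hE₀' : ‖exp (-Xavg L V₀ q κ) - 1‖ ≤ 1 / 16 :=
    (norm_exp_sub_one_le_two_mul ((norm_neg _).le.trans (hX₀.trans (by norm_num)))).trans
      (by rw [norm_neg]; linarith)
  have hF : ∀ y : Site d, (∀ r : Fin d → Fin L,
      ‖((tHol V₀ (expCfg A) y (treeWord (boxVec L r)) : 𝔸ˣ) : 𝔸) - 1‖ ≤ 1 / 32) →
      ‖((wframe L V₀ (expCfg A) y : 𝔸ˣ) : 𝔸) - 1‖ ≤ 1 / 8 ∧
        ‖(((wframe L V₀ (expCfg A) y)⁻¹ : 𝔸ˣ) : 𝔸) - 1‖ ≤ 1 / 8 := by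
    intro y hy
    have hFy : ‖Fcov L V₀ (expCfg A) y‖ ≤ 1 / 16 :=
      (norm_Fcov_le_of_tHol hL V₀ _ y hy (by norm_num)).trans (by norm_num)
    refine ⟨?_, ?_⟩
    · rw [wframe, val_expUnit]
      exact (norm_exp_sub_one_le_two_mul (hFy.trans (by norm_num))).trans (by linarith)
    · rw [wframe, val_inv_expUnit, val_expUnit]
      exact (norm_exp_sub_one_le_two_mul ((norm_neg _).le.trans (hFy.trans (by norm_num)))).trans
        (by rw [norm_neg]; linarith)
  -- `Ṽ₁(c) = e^{X'}·t·e^{−X₀}` is within `3/8` of `1`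
  have htild : ‖((tild L V₀ (expCfg A) q κ : 𝔸ˣ) : 𝔸) - 1‖ ≤ 3 / 8 := by
    rw [tild_eq_exp_tHol_exp, Units.val_mul, Units.val_mul, val_expUnit, val_expUnit]
    have h1 := norm_mul_sub_one_le hE' (hτ _ q hseg) (by norm_num)
    refine (norm_mul_sub_one_le h1 hE₀' (by norm_num)).trans ?_
    norm_num
  -- the rotated frame `R̄_{0,c} w(c₊) = V̄₀(c)·w(c₊)·V̄₀(c)⁻¹` is within `1/7` of `1`
  have hb₀ : ‖((bavg L V₀ q κ : 𝔸ˣ) : 𝔸)‖ ≤ 17 / 16 := by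
    rw [val_bavg]
    refine (norm_mul_le _ _).trans ?_
    have h1 := norm_le_one_add_norm_sub_one (exp (Xavg L V₀ q κ))
    have h2 := (mem_U1.1 (hol_mem hV₀ q (seg κ (L : ℤ)))).1
    nlinarith [norm_nonneg (exp (Xavg L V₀ q κ)), norm_nonneg (((hol V₀ q (seg κ (L : ℤ))) : 𝔸ˣ) : 𝔸)]
  have hb₀' : ‖(((bavg L V₀ q κ)⁻¹ : 𝔸ˣ) : 𝔸)‖ ≤ 17 / 16 := by
    have hv : (((bavg L V₀ q κ)⁻¹ : 𝔸ˣ) : 𝔸) = (((hol V₀ q (seg κ L))⁻¹ : 𝔸ˣ) : 𝔸) * exp (-Xavg L V₀ q κ) := by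
      simp only [bavg, mul_inv_rev, val_inv_expUnit, Units.val_mul, val_expUnit]
    rw [hv]
    refine (norm_mul_le _ _).trans ?_
    have h1 := norm_le_one_add_norm_sub_one (exp (-Xavg L V₀ q κ))
    have h2 := (mem_U1.1 (hol_mem hV₀ q (seg κ (L : ℤ)))).2
    nlinarith [norm_nonneg (exp (-Xavg L V₀ q κ)), norm_nonneg ((((hol V₀ q (seg κ (L : ℤ))))⁻¹ : 𝔸ˣ) : 𝔸)]
  have hZ : ‖((bavg L V₀ q κ : 𝔸ˣ) : 𝔸) * ((wframe L V₀ (expCfg A) (q + (L : ℤ) • e κ) : 𝔸ˣ) : 𝔸)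
      * (((bavg L V₀ q κ)⁻¹ : 𝔸ˣ) : 𝔸) - 1‖ ≤ 1 / 7 := by
    have hw := (hF _ hT₂).1
    have he : ((bavg L V₀ q κ : 𝔸ˣ) : 𝔸) * ((wframe L V₀ (expCfg A) (q + (L : ℤ) • e κ) : 𝔸ˣ) : 𝔸)
        * (((bavg L V₀ q κ)⁻¹ : 𝔸ˣ) : 𝔸) - 1
        = ((bavg L V₀ q κ : 𝔸ˣ) : 𝔸) * (((wframe L V₀ (expCfg A) (q + (L : ℤ) • e κ) : 𝔸ˣ) : 𝔸) - 1)
          * (((bavg L V₀ q κ)⁻¹ : 𝔸ˣ) : 𝔸) := by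
      rw [mul_sub, sub_mul, mul_one, Units.mul_inv]
    rw [he]
    refine (norm_mul_le _ _).trans ((mul_le_mul (norm_mul_le _ _) hb₀' (norm_nonneg _)
      (mul_nonneg (norm_nonneg _) (norm_nonneg _))).trans ?_)
    nlinarith [norm_nonneg ((bavg L V₀ q κ : 𝔸ˣ) : 𝔸),
      norm_nonneg (((wframe L V₀ (expCfg A) (q + (L : ℤ) • e κ) : 𝔸ˣ) : 𝔸) - 1), mul_le_mul hb₀ hw (norm_nonneg _) (by norm_num)]
  -- assemble (89): `V̿₁(c) = w(c₋)⁻¹ · Ṽ₁(c) · R̄_{0,c} w(c₊)`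
  rw [dbavgCov_apply, Units.val_mul, Units.val_mul, Rc_apply, Units.val_mul, Units.val_mul]
  have h1 := norm_mul_sub_one_le (hF q hT₁).2 htild (by norm_num)
  refine (norm_mul_sub_one_le h1 hZ (by norm_num)).trans ?_
  norm_num

/-- … in particular all four are `< 1`: the contour words entering (89) and `V̿₁(c)` itself lie in the domain of the
series logarithm (21). [cite: Balaban1985Averaging, (120)–(121) pp.35–36] -/
theorem logDomainCov_lt {L : ℕ} (hL : 1 ≤ L) {V₀ : Site d → Fin d → 𝔸ˣ} (hV₀ : ∀ x κ, V₀ x κ ∈ U1 𝔸)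
    (A : Site d → Fin d → 𝔸) {a θ α : ℝ} (ha : 0 ≤ a) (hA : ∀ x κ, ‖A x κ‖ ≤ a)
    (hθ : ((2 * (d * L) + L + L : ℕ) : ℝ) * a ≤ θ) (hθ0 : 0 ≤ θ) (hθ1 : θ ≤ 1 / 64)
    (q : Site d) (κ : Fin d) (hα1 : α ≤ 1 / 64)
    (hreg : ∀ r : Fin d → Fin L, ‖((Wcx L V₀ q κ (boxVec L r) : 𝔸ˣ) : 𝔸) - 1‖ ≤ α) :
    (∀ r : Fin d → Fin L, ‖((Wcx L (expCfg A * V₀) q κ (boxVec L r) : 𝔸ˣ) : 𝔸) - 1‖ < 1) ∧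
    (∀ r : Fin d → Fin L, ‖((tHol V₀ (expCfg A) q (treeWord (boxVec L r)) : 𝔸ˣ) : 𝔸) - 1‖ < 1) ∧
    (∀ r : Fin d → Fin L,
      ‖((tHol V₀ (expCfg A) (q + (L : ℤ) • e κ) (treeWord (boxVec L r)) : 𝔸ˣ) : 𝔸) - 1‖ < 1) ∧
    ‖((dbavgCov L V₀ (expCfg A) q κ : 𝔸ˣ) : 𝔸) - 1‖ < 1 := by
  obtain ⟨hW, hT₁, hT₂, hD⟩ := logDomainCov hL hV₀ A ha hA hθ hθ0 hθ1 q κ hα1 hreg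
  exact ⟨fun r => (hW r).trans_lt (by norm_num), fun r => (hT₁ r).trans_lt (by norm_num),
    fun r => (hT₂ r).trans_lt (by norm_num), hD.trans_lt (by norm_num)⟩

/-- **`Q(V₀, A, c)` IS BOUNDED ON ITS DOMAIN**: `|log V̿₁(c)| ≤ 4` there (`|log W| ≤ |W − 1|/(1 − |W − 1|)` with
`|V̿₁(c) − 1| ≤ 4/5`) — the bound the Cauchy estimate for the second-order remainder (123) consumes.
[cite: Balaban1985Averaging, (121)–(123) p.36] -/
theorem norm_mlog_dbavgCov_le {L : ℕ} (hL : 1 ≤ L) {V₀ : Site d → Fin d → 𝔸ˣ} (hV₀ : ∀ x κ, V₀ x κ ∈ U1 𝔸)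
    (A : Site d → Fin d → 𝔸) {a θ α : ℝ} (ha : 0 ≤ a) (hA : ∀ x κ, ‖A x κ‖ ≤ a)
    (hθ : ((2 * (d * L) + L + L : ℕ) : ℝ) * a ≤ θ) (hθ0 : 0 ≤ θ) (hθ1 : θ ≤ 1 / 64)
    (q : Site d) (κ : Fin d) (hα1 : α ≤ 1 / 64)
    (hreg : ∀ r : Fin d → Fin L, ‖((Wcx L V₀ q κ (boxVec L r) : 𝔸ˣ) : 𝔸) - 1‖ ≤ α) :
    ‖mlog ((dbavgCov L V₀ (expCfg A) q κ : 𝔸ˣ) : 𝔸)‖ ≤ 4 := by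
  have hD := (logDomainCov hL hV₀ A ha hA hθ hθ0 hθ1 q κ hα1 hreg).2.2.2
  refine (norm_mlog_le_div (hD.trans_lt (by norm_num))).trans ?_
  rw [div_le_iff₀ (by linarith)]
  linarith

end Estimates

section Prop3

variable {𝔸 : Type*} [NormedRing 𝔸] [NormedAlgebra ℂ 𝔸] [CompleteSpace 𝔸] [NormOneClass 𝔸]
variable {E : Type*} [NormedAddCommGroup E] [NormedSpace ℂ E]

/-- **PROPOSITION 3, THE ANALYTICITY CLAUSE (121) AT A GENERAL BACKGROUND**: "Q(V₀, A, c) = (1/i) log (V̿₁)_c […] is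
an analytic function of A […] for |A_b| < c₃(d, L)" — for a unit-bounded background `V₀` with `α`-regular block contours
at `c` (`α ≤ 1/64`) and a field `B(t)` depending analytically on a parameter `t`, with `(2d+2)L·sup_b|B(t₀)_b| ≤ θ ≤ 1/64`
(so `c₃(d, L) = 1/(128(d+1)L)` = `B7Prop3Flat.c3` will do), `t ↦ log V̿₁(c)[e^{B(t)}]` is analytic at `t₀`.  The
parametrised shape is the one the `k`-fold composition (63)/(128) consumes (`B7Prop3Flat.prop3_flat_analyticAt` is the case
`V₀ = 1`). [cite: Balaban1985Averaging, Proposition 3 (121) p.36] -/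
theorem prop3_general_analyticAt (B : E → Site d → Fin d → 𝔸) {t₀ : E}
    (hB : ∀ x κ, AnalyticAt ℂ (fun t => B t x κ) t₀) {L : ℕ} (hL : 1 ≤ L)
    {V₀ : Site d → Fin d → 𝔸ˣ} (hV₀ : ∀ x κ, V₀ x κ ∈ U1 𝔸) {a θ α : ℝ} (ha : 0 ≤ a)
    (hA : ∀ x κ, ‖B t₀ x κ‖ ≤ a) (hθ : ((2 * (d * L) + L + L : ℕ) : ℝ) * a ≤ θ) (hθ0 : 0 ≤ θ) (hθ1 : θ ≤ 1 / 64)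
    (q : Site d) (κ : Fin d) (hα1 : α ≤ 1 / 64)
    (hreg : ∀ r : Fin d → Fin L, ‖((Wcx L V₀ q κ (boxVec L r) : 𝔸ˣ) : 𝔸) - 1‖ ≤ α) :
    AnalyticAt ℂ (fun t => mlog ((dbavgCov L V₀ (expCfg (B t)) q κ : 𝔸ˣ) : 𝔸)) t₀ := by
  obtain ⟨hW, hT₁, hT₂, hD⟩ := logDomainCov_lt hL hV₀ (B t₀) ha hA hθ hθ0 hθ1 q κ hα1 hreg
  exact analyticAt_mlog_dbavgCov_expCfg B hB L V₀ q κ hW hT₁ hT₂ hD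

/-- The same under print's threshold `|A_b| ≤ a ≤ c₃(d, L)`, `c₃ = B7Prop3Flat.c3 d L = 1/(128(d+1)L)`.
[cite: Balaban1985Averaging, Proposition 3 (121) p.36] -/
theorem prop3_general_analyticAt_of_le_c3 (B : E → Site d → Fin d → 𝔸) {t₀ : E}
    (hB : ∀ x κ, AnalyticAt ℂ (fun t => B t x κ) t₀) {L : ℕ} (hL : 1 ≤ L)
    {V₀ : Site d → Fin d → 𝔸ˣ} (hV₀ : ∀ x κ, V₀ x κ ∈ U1 𝔸) {a α : ℝ} (ha : 0 ≤ a)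
    (hA : ∀ x κ, ‖B t₀ x κ‖ ≤ a) (hac : a ≤ c3 d L)
    (q : Site d) (κ : Fin d) (hα1 : α ≤ 1 / 64)
    (hreg : ∀ r : Fin d → Fin L, ‖((Wcx L V₀ q κ (boxVec L r) : 𝔸ˣ) : 𝔸) - 1‖ ≤ α) :
    AnalyticAt ℂ (fun t => mlog ((dbavgCov L V₀ (expCfg (B t)) q κ : 𝔸ˣ) : 𝔸)) t₀ := by
  have hL1 : (1 : ℝ) ≤ L := by exact_mod_cast hL
  have hcast : ((2 * (d * L) + L + L : ℕ) : ℝ) = 2 * ((d : ℝ) + 1) * L := by push_cast; ring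
  refine prop3_general_analyticAt B hB hL hV₀ ha hA (θ := ((2 * (d * L) + L + L : ℕ) : ℝ) * a) le_rfl
    (by positivity) ?_ q κ hα1 hreg
  rw [hcast]
  have hpos : (0 : ℝ) < 128 * ((d : ℝ) + 1) * L := by positivity
  have h1 : a * (128 * ((d : ℝ) + 1) * L) ≤ 1 := by
    have := mul_le_mul_of_nonneg_right hac hpos.le
    rwa [c3, one_div, inv_mul_cancel₀ hpos.ne'] at this
  nlinarith

end Prop3

end Literature.MathematicalPhysics.QuantumFieldTheory.Balaban1983to89.B7Prop3GeneralAnalytic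

end
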